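import Literature.Geometry.Lorentzian.KerrNullRadialPotential
import Literature.Geometry.Lorentzian.SpacetimeLocalConvergence
import Literature.Geometry.Lorentzian.CoordScalarCurvatureEvolution
import Literature.Geometry.Lorentzian.KerrSchildCoord
import Literature.Geometry.Lorentzian.SpacetimeMetricInCoordsCalculus
import Literature.Geometry.Lorentzian.CoordScalarJet
import HarnessLib

/-!
# `KerrCylindersBendInward`: the glue (B) → (C) → `KerrCylindersBendInward'`
(crux `GapExhaustion`, stmt-FinalStateConjecture-10808, line photon-shell-pseudoconvexity;
sub-stub (E) of the reshaped geometric input `KerrCylindersBendInward`)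

Given

* (B) the exact-Kerr margin: on a radial band `r₊ < r_lo ≤ r ≤ r_e < r_ph⁺` of the Kerr–Schild
  chart the coordinate Hessian of the Kerr–Schild radius `r` with respect to the Kerr–Schild
  components `g_{M,a}` is `≤ −m‖w‖²` on null vectors tangent to the cylinders `{r = c}`
  (at all times `x⁰`), and
* (C) the generic `C¹`-stability of such a margin over a compact set under a `δ`-perturbation of
  the `1`-jet of the components at the point,

we deduce the time-uniform statement `KerrCylindersBendInward'` for every spacetime chart whose
pulled-back components (`Spacetime.metricInCoords`) are `δ`-close in `C²` sup norm
(`supCkENorm`) to `g_{M,a}` on the band: apply (C) on the compact time slice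
`{x⁰ = 0, r_lo ≤ r ≤ r_e}` and transport to arbitrary times by the stationarity of Kerr
(`Kerr.bilin_add_smul_basisVector_zero`, `Kerr.radius_add_time_smul_basisVector`) and the
naturality of the coordinate Hessian under translations (`MetricCoord.chrAt_comp_add_right`,
`fderiv_comp_add_right`).
-/

noncomputable section

-- instance search through the nested operator types `E4 →L[ℝ] E4 →L[ℝ] E4 →L[ℝ] ℝ`
set_option maxSynthPendingDepth 3

-- D-0017: single-problem summit, `Summit.<S>.<S>.…` by design (cf. lakefile `weak.linter.dupNamespace`).
set_option linter.dupNamespace false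

namespace Summit.FinalStateConjecture.FinalStateConjecture.Theorems

open Literature.Geometry.Lorentzian Literature.Geometry.Lorentzian.MetricCoord
open scoped Manifold ContDiff Topology ENNReal

/-- **Naturality of the coordinate Hessian under translations**:
`Hess_{G ∘ (· + c)} (f ∘ (· + c)) (x) = Hess_G f (x + c)` (every ingredient — `D²f`, `Df`, `♯`, the
Koszul form — is built from `fderiv`, which commutes with translations). -/
theorem kerrCylindersBendInward_hessAt_comp_add_right
    (G : E4 → E4 →L[ℝ] E4 →L[ℝ] ℝ) (f : E4 → ℝ) (c x : E4) :
    hessAt (fun y ↦ G (y + c)) (fun y ↦ f (y + c)) x = hessAt G f (x + c) := by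
  have h1 : fderiv ℝ (fun y ↦ f (y + c)) = fun y ↦ fderiv ℝ f (y + c) :=
    funext fun y ↦ fderiv_comp_add_right c
  unfold hessAt
  rw [chrAt_comp_add_right, h1, fderiv_comp_add_right]

/-- The time slice `{x⁰ = 0, r_lo ≤ r ≤ r_e}` of a radial band with `r_lo > 0` is compact: closed
by continuity of `x ↦ x⁰` and of the Kerr–Schild radius, bounded by `‖x⃗‖² ≤ r² + a²`. -/
theorem kerrCylindersBendInward_isCompact_slice (a : ℝ) {r_lo : ℝ} (r_e : ℝ) (hlo : 0 < r_lo) :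
    IsCompact {z : E4 | z 0 = 0 ∧ r_lo ≤ Kerr.radius a z ∧ Kerr.radius a z ≤ r_e} := by
  refine Metric.isCompact_of_isClosed_isBounded ?_ ?_
  · have hc : Continuous fun x : E4 ↦ x 0 := (E4.dx 0).continuous
    exact (isClosed_eq hc continuous_const).and
      ((isClosed_le continuous_const (Kerr.continuous_radius a)).and
        (isClosed_le (Kerr.continuous_radius a) continuous_const))
  · rw [isBounded_iff_forall_norm_le]
    refine ⟨√(r_e ^ 2 + a ^ 2), fun x hx ↦ ?_⟩
    obtain ⟨hx0, hxlo, hxe⟩ := hx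
    have hr : 0 < Kerr.radius a x := hlo.trans_le hxlo
    have hsq : ‖x‖ ^ 2 ≤ r_e ^ 2 + a ^ 2 := by
      rw [EuclideanSpace.real_norm_sq_eq, Fin.sum_univ_four, hx0]
      have h1 := Kerr.spatialNorm_sq_sub_sq_le_radius_sq a x
      rw [E4.spatialNorm_sq] at h1
      have h2 : Kerr.radius a x ^ 2 ≤ r_e ^ 2 := pow_le_pow_left₀ hr.le hxe 2
      linarith
    calc ‖x‖ = √(‖x‖ ^ 2) := (Real.sqrt_sq (norm_nonneg x)).symm
      _ ≤ √(r_e ^ 2 + a ^ 2) := Real.sqrt_le_sqrt hsq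

/-- **(E) The glue `(B) → (C) → KerrCylindersBendInward'`.** From the exact-Kerr Hessian margin
`−m` on the band `r_lo ≤ r ≤ r_e` (hypothesis (B)) and the `C¹`-stability of Hessian margins on
null tangent vectors over compact sets (hypothesis (C)), applied on the compact time slice
`{x⁰ = 0, r_lo ≤ r ≤ r_e}` with `G₀ = g_{M,a}`, `f = r`, `μ = m/2`: for every spacetime chart
`Φ` on the eternal region `{M < r < 4M}` whose pulled-back components are `δ`-close to `g_{M,a}`
in `C²` sup norm on the band, the coordinate Hessian of `r` is `≤ −(m/2)‖w‖²` on null vectors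
tangent to the cylinders at every band point and every time — a band point `z` at time `t = z⁰`
is translated to the slice (`z = z' + t ∂₀`), the components are translated along
(`y ↦ (Φ^* g)(y + t ∂₀)`), and Kerr is stationary, so the `1`-jets at `z'` of the translated
components relative to `g_{M,a}` are those at `z`, bounded by the sup norm, while the Hessian is
natural under translations. -/
theorem stub_kerrCylindersBendInward_of :
    (∀ (M a r_lo r_e : ℝ), 0 < M → |a| < M → Kerr.rPlus M a < r_lo → r_lo < r_e →
      r_e < Kerr.photonOrbitRadius M (-|a|) →
      ∃ m : ℝ, 0 < m ∧ ∀ (z w : E4), r_lo ≤ Kerr.radius a z → Kerr.radius a z ≤ r_e →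
        Kerr.bilin M a z w w = 0 → fderiv ℝ (Kerr.radius a) z w = 0 →
        hessAt (Kerr.bilin M a) (Kerr.radius a) z w w ≤ -m * ‖w‖ ^ 2) →
    (∀ (G₀ : E4 → E4 →L[ℝ] E4 →L[ℝ] ℝ) (f : E4 → ℝ) (S : Set E4) (μ : ℝ), IsCompact S → 0 < μ →
      (∃ U : Set E4, IsOpen U ∧ S ⊆ U ∧ ContDiffOn ℝ 1 G₀ U ∧ ContDiffOn ℝ 2 f U) →
      (∀ x ∈ S, (G₀ x).IsInvertible) →
      (∀ x ∈ S, ∀ w : E4, G₀ x w w = 0 → fderiv ℝ f x w = 0 →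
        hessAt G₀ f x w w ≤ -(2 * μ) * ‖w‖ ^ 2) →
      ∃ δ : ℝ, 0 < δ ∧ ∀ x ∈ S, ∀ G : E4 → E4 →L[ℝ] E4 →L[ℝ] ℝ,
        ‖G x - G₀ x‖ ≤ δ → ‖fderiv ℝ G x - fderiv ℝ G₀ x‖ ≤ δ →
        ∀ w : E4, G x w w = 0 → fderiv ℝ f x w = 0 → hessAt G f x w w ≤ -μ * ‖w‖ ^ 2) →
    (∀ (M a r_lo r_e : ℝ), 0 < M → |a| < M → Kerr.rPlus M a < r_lo → r_lo < r_e →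
      r_e < Kerr.photonOrbitRadius M (-|a|) →
      ∃ (δ μ : ℝ), 0 < δ ∧ 0 < μ ∧
      ∀ (𝓢 : Spacetime.{0} 4) (Φ : E4 → 𝓢.carrier),
        ContMDiffOn 𝓘(ℝ, E4) (𝓡 4) ∞ Φ {z | M < Kerr.radius a z ∧ Kerr.radius a z < 4 * M} →
        Topology.IsOpenEmbedding
          ({z : E4 | M < Kerr.radius a z ∧ Kerr.radius a z < 4 * M}.restrict Φ) →
        supCkENorm {z | (M < Kerr.radius a z ∧ Kerr.radius a z < 4 * M) ∧
            r_lo ≤ Kerr.radius a z ∧ Kerr.radius a z ≤ r_e} 2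
            (fun z => 𝓢.metricInCoords Φ z - Kerr.bilin M a z) ≤ ENNReal.ofReal δ →
        ∀ z ∈ {z : E4 | M < Kerr.radius a z ∧ Kerr.radius a z < 4 * M}, ∀ w : E4,
          r_lo ≤ Kerr.radius a z → Kerr.radius a z ≤ r_e →
          𝓢.metricInCoords Φ z w w = 0 → fderiv ℝ (Kerr.radius a) z w = 0 →
          hessAt (𝓢.metricInCoords Φ) (Kerr.radius a) z w w ≤ -μ * ‖w‖ ^ 2) := by
  intro hB hC M a r_lo r_e hM ha hlo hloe he
  obtain ⟨m, hm, hmargin⟩ := hB M a r_lo r_e hM ha hlo hloe he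
  -- the radius is positive on the band: `r ≥ r_lo > r₊ ≥ M > 0`
  have hrPlus : M ≤ Kerr.rPlus M a := le_add_of_nonneg_right (Real.sqrt_nonneg _)
  have hlo0 : 0 < r_lo := hM.trans (hrPlus.trans_lt hlo)
  -- the compact time slice of the band, inside the open set `{r > 0}`
  set S : Set E4 := {z | z 0 = 0 ∧ r_lo ≤ Kerr.radius a z ∧ Kerr.radius a z ≤ r_e} with hSdef
  have hS : IsCompact S := kerrCylindersBendInward_isCompact_slice a r_e hlo0
  have hSpos : ∀ z ∈ S, 0 < Kerr.radius a z := fun z hz ↦ hlo0.trans_le hz.2.1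
  have hU : ∃ U : Set E4, IsOpen U ∧ S ⊆ U ∧ ContDiffOn ℝ 1 (Kerr.bilin M a) U ∧
      ContDiffOn ℝ 2 (Kerr.radius a) U :=
    ⟨{z | 0 < Kerr.radius a z}, isOpen_lt continuous_const (Kerr.continuous_radius a), hSpos,
      fun z hz ↦ (Kerr.contDiffAt_bilin M a hz).contDiffWithinAt,
      fun z hz ↦ (Kerr.contDiffAt_radius hz).contDiffWithinAt⟩
  have hinv : ∀ z ∈ S, (Kerr.bilin M a z).IsInvertible := fun z hz ↦
    isInvertible_of_nondegenerate fun v hv ↦ Kerr.bilin_nondegenerate M a (hSpos z hz) v hv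
  have h2m : (2 : ℝ) * (m / 2) = m := by ring
  have hmarginS : ∀ z ∈ S, ∀ w : E4, Kerr.bilin M a z w w = 0 →
      fderiv ℝ (Kerr.radius a) z w = 0 →
      hessAt (Kerr.bilin M a) (Kerr.radius a) z w w ≤ -(2 * (m / 2)) * ‖w‖ ^ 2 := by
    intro z hz w hnull hdr
    rw [h2m]
    exact hmargin z w hz.2.1 hz.2.2 hnull hdr
  obtain ⟨δ, hδ, hstab⟩ :=
    hC (Kerr.bilin M a) (Kerr.radius a) S (m / 2) hS (half_pos hm) hU hinv hmarginS
  refine ⟨δ, m / 2, hδ, half_pos hm, ?_⟩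
  intro 𝓢 Φ hΦ _ hsup z hz w hzlo hze hnull hdr
  -- smoothness of the pulled-back components on the open eternal region, and of `g_{M,a}`
  have hO : IsOpen {z : E4 | M < Kerr.radius a z ∧ Kerr.radius a z < 4 * M} :=
    (isOpen_lt continuous_const (Kerr.continuous_radius a)).and
      (isOpen_lt (Kerr.continuous_radius a) continuous_const)
  have hGdiff : DifferentiableAt ℝ (𝓢.metricInCoords Φ) z :=
    (((𝓢.contDiffOn_metricInCoords hO hΦ) z hz).contDiffAt (hO.mem_nhds hz)).differentiableAt
      (by simp)
  have hzpos : 0 < Kerr.radius a z := hlo0.trans_le hzlo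
  have hKdiff : DifferentiableAt ℝ (Kerr.bilin M a) z :=
    (Kerr.contDiffAt_bilin M a hzpos (n := 1)).differentiableAt one_ne_zero
  -- pointwise `C¹`-closeness at `z` from the `C²` sup norm over the band
  have hzK : z ∈ {z : E4 | (M < Kerr.radius a z ∧ Kerr.radius a z < 4 * M) ∧
      r_lo ≤ Kerr.radius a z ∧ Kerr.radius a z ≤ r_e} := ⟨hz, hzlo, hze⟩
  have hjet : ∀ k ≤ 2,
      ‖iteratedFDeriv ℝ k (fun z ↦ 𝓢.metricInCoords Φ z - Kerr.bilin M a z) z‖ ≤ δ := by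
    intro k hk
    have h := (enorm_iteratedFDeriv_le_supCkENorm hk hzK
      (fun z ↦ 𝓢.metricInCoords Φ z - Kerr.bilin M a z)).trans hsup
    rwa [← ofReal_norm, ENNReal.ofReal_le_ofReal_iff hδ.le] at h
  have hd0 : ‖𝓢.metricInCoords Φ z - Kerr.bilin M a z‖ ≤ δ := by
    have h := hjet 0 (by norm_num)
    rwa [norm_iteratedFDeriv_zero] at h
  have hd1 : ‖fderiv ℝ (𝓢.metricInCoords Φ) z - fderiv ℝ (Kerr.bilin M a) z‖ ≤ δ := by
    have h := hjet 1 (by norm_num)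
    rwa [norm_iteratedFDeriv_one, fderiv_fun_sub hGdiff hKdiff] at h
  -- translate `z` to the time slice: `z = z' + t ∂₀`, `t = z⁰`
  obtain ⟨t, ht⟩ : ∃ t : ℝ, z 0 = t := ⟨_, rfl⟩
  obtain ⟨z', hz'z⟩ : ∃ z' : E4, z' + t • E4.basisVector 0 = z :=
    ⟨z - t • E4.basisVector 0, sub_add_cancel z _⟩
  have hz'0 : z' 0 = 0 := by
    have h : (z' + t • E4.basisVector 0) 0 = z 0 := by rw [hz'z]
    rw [ht] at h
    simpa [E4.basisVector] using h
  -- stationarity of Kerr: the radius, the components and their first derivatives agree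
  have hradfun : (fun y : E4 ↦ Kerr.radius a (y + t • E4.basisVector 0)) = Kerr.radius a :=
    funext fun y ↦ Kerr.radius_add_time_smul_basisVector a y t
  have hbilfun : (fun y : E4 ↦ Kerr.bilin M a (y + t • E4.basisVector 0)) = Kerr.bilin M a :=
    funext fun y ↦ Kerr.bilin_add_smul_basisVector_zero M a y t
  have hrad' : Kerr.radius a z' = Kerr.radius a z := by
    rw [← hz'z, Kerr.radius_add_time_smul_basisVector]
  have hbil' : Kerr.bilin M a z' = Kerr.bilin M a z := by
    rw [← hz'z, Kerr.bilin_add_smul_basisVector_zero]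
  have hfdrad' : fderiv ℝ (Kerr.radius a) z' = fderiv ℝ (Kerr.radius a) z := by
    rw [← hz'z, ← fderiv_comp_add_right (t • E4.basisVector 0)]
    exact (congrArg (fun g : E4 → ℝ ↦ fderiv ℝ g z') hradfun).symm
  have hfdbil' : fderiv ℝ (Kerr.bilin M a) z' = fderiv ℝ (Kerr.bilin M a) z := by
    rw [← hz'z, ← fderiv_comp_add_right (t • E4.basisVector 0)]
    exact (congrArg (fun g : E4 → E4 →L[ℝ] E4 →L[ℝ] ℝ ↦ fderiv ℝ g z') hbilfun).symm
  have hz'S : z' ∈ S := by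
    rw [hSdef]
    exact ⟨hz'0, hzlo.trans_eq hrad'.symm, hrad'.trans_le hze⟩
  -- the translated components `y ↦ (Φ^* g)(y + t ∂₀)` and the naturality of the Hessian
  have hGt1 : fderiv ℝ (fun y ↦ 𝓢.metricInCoords Φ (y + t • E4.basisVector 0)) z' =
      fderiv ℝ (𝓢.metricInCoords Φ) z := by
    rw [fderiv_comp_add_right, hz'z]
  have hH : hessAt (fun y ↦ 𝓢.metricInCoords Φ (y + t • E4.basisVector 0)) (Kerr.radius a) z' =
      hessAt (𝓢.metricInCoords Φ) (Kerr.radius a) z := by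
    have h := kerrCylindersBendInward_hessAt_comp_add_right (𝓢.metricInCoords Φ) (Kerr.radius a)
      (t • E4.basisVector 0) z'
    rw [hradfun, hz'z] at h
    exact h
  have key := hstab z' hz'S (fun y ↦ 𝓢.metricInCoords Φ (y + t • E4.basisVector 0))
    (by
      show ‖𝓢.metricInCoords Φ (z' + t • E4.basisVector 0) - Kerr.bilin M a z'‖ ≤ δ
      rw [hz'z, hbil']
      exact hd0)
    (by
      rw [hGt1, hfdbil']
      exact hd1)
    w
    (by
      show 𝓢.metricInCoords Φ (z' + t • E4.basisVector 0) w w = 0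
      rw [hz'z]
      exact hnull)
    (by
      rw [hfdrad']
      exact hdr)
  rw [hH] at key
  exact key

end Summit.FinalStateConjecture.FinalStateConjecture.Theorems

end
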